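import Literature.NumberTheory.Automorphic.FuchsianEisensteinTruncation
import Literature.NumberTheory.Automorphic.FuchsianUnfoldingBounded
import Literature.NumberTheory.Automorphic.FuchsianIncompleteEisensteinConstantTerm

/-!
# The truncated Eisenstein series as cut incomplete Eisenstein series, and the easy Maass–Selberg pairings
(Iwaniec, *Spectral Methods of Automorphic Forms*, GSM 53, §6.4: (6.29) and Proposition 6.8
(Maass–Selberg, (6.30)), PDF p. 88; (3.16) & Lemma 3.3, PDF p. 44)

Twelfth brick of the general-`Γ` Eisenstein series (after `FuchsianEisensteinTruncation`,
`FuchsianUnfoldingBounded`), first half of a proof of the **Maass–Selberg relations (6.30) by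
unfolding** (no fundamental polygon, no Green's formula, no Fourier tails) for `Re s₁, Re s₂ > 1`.
The book derives (6.30) "by application of Green's formula to the central part `F(Y)` of a
fundamental polygon"; here the truncated Eisenstein series of the previous brick is rewritten as
a combination of incomplete Eisenstein series with CUT POWER profiles, each BOUNDED, whose
pairings on `F` are then computed by the bounded Lemma 3.3. For a discrete `Γ ≤ SL₂(ℝ)`
(`-1 ∈ Γ`), a system of inequivalent cusps with width-one scaling matrices, `Y ≥ 1`; everything
PROVED, nothing vendored, no fact introduced:

1. (§1) the cut powers `cutHigh w Y = y^w𝟙_{y>Y}`, `cutLow s Y = y^s𝟙_{y≤Y}`, the linearity of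
   `ψ ↦ E(z|ψ)` (`incEis_add`, `incEis_const_mul`), `E_𝔞(z, s) = E_𝔞(z|y^s)`
   (`eisCusp_eq_incEisCusp`) and the split **`E_𝔞(·, s) = E_𝔞(·|y^s𝟙_{y≤Y}) + E_𝔞(·|y^s𝟙_{y>Y})`**
   for `Re s > 1` (`eisCusp_eq_low_add_high`); `truncProfile = δ·cutHigh s + φ·cutHigh (1-s)`.
2. (§2) **the decomposition** (`eisTrunc_eq_decomp`):
   `E^Y_𝔞ᵢ(·, s) = E_𝔞ᵢ(·|y^s𝟙_{y≤Y}) - Σₖ φᵢₖ(s) E_𝔞ₖ(·|y^{1-s}𝟙_{y>Y})` — the series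
   `E_𝔞ᵢ(·|y^s𝟙_{y>Y})` being exactly the `δ`-part of the correction in the zone of `𝔞ᵢ`.
3. (§3) the pieces: `E_𝔞ₖ(·|y^w𝟙_{y>Y})` is bounded by `Y^{Re w}(1 + 36/Y)` (`Re w ≤ 0`) and
   measurable; on every horocycle above `Y` it equals `δₖₗ y^w` in the frame of `𝔞ₗ`
   (`incEisCusp_cutHigh_horocycle`, hence its constant term `cuspMeanAt_incEisCusp_cutHigh`); the
   low piece `E_𝔞ᵢ(·|y^s𝟙_{y≤Y}) = E_𝔞ᵢ(·, s) - δᵢₗ y^s` there (`incEisCusp_cutLow_horocycle`), so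
   **its constant term above `Y` at `𝔞ₗ` is the full reflected term `φᵢₗ(s) y^{1-s}`**
   (`cuspMeanAt_incEisCusp_cutLow`), and it is measurable and **bounded on `ℍ`** for a finite volume
   group with a complete cusp system (`exists_norm_incEisCusp_cutLow_le`).
4. (§4) **the easy pairings** of (6.30) (bounded Lemma 3.3 `setIntegral_incEisCusp_mul_of_bounded`,
   tail integral `integral_tail_eq`: `∫_Y^∞ y^{w₁+w₂-2} dy = -Y^{w₁+w₂-1}/(w₁+w₂-1)`):
   `∫_F E_𝔞ₖ(·|y^{w₁}𝟙_{>Y}) E_𝔞ₗ(·|y^{w₂}𝟙_{>Y}) dμ = δₖₗ (-Y^{w₁+w₂-1}/(w₁+w₂-1))`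
   (`pairing_cutHigh_cutHigh`, `Re wᵢ ≤ 0`) and
   `∫_F E_𝔞ᵢ(·|y^s𝟙_{≤Y}) E_𝔞ₖ(·|y^w𝟙_{>Y}) dμ = φᵢₖ(s) (-Y^{w-s}/(w-s))`
   (`pairing_cutLow_cutHigh`, `Re s > 1`, `Re w ≤ 0`). With `wᵢ = 1 - sᵢ` these are three of the
   four terms of (6.30); the remaining low–low pairing (the non-identity double cosets) is the next brick.

## References
* [Iwaniec2002] H. Iwaniec, *Spectral Methods of Automorphic Forms*, 2nd ed., GSM 53, AMS 2002,
  §6.4 (6.29)–(6.30) & Prop. 6.8, PDF p. 88; Lemma 3.3 & (3.16), PDF p. 44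
  (held copy `book:iwaniec2002-spectral-methods-automorphic-forms`).

Mathlib: `integral_Ioi_cpow_of_lt`, `Complex.cpow_add/neg/natCast`, `Finset.sum_ite_eq`, `boole_mul`,
`Summable.tsum_add`, `tsum_mul_left`, `Measurable.ite`. Literature: `eisTrunc`, `truncProfile`,
`measurable_incEisCusp`, `incEisCusp_frame_eq_zero_of_ne`, `incEisCusp_eq_zero_of_invHeight_le`
(`FuchsianEisensteinTruncation`); `setIntegral_incEisCusp_mul_of_bounded`, `integrableOn_highProfile`
(`FuchsianUnfoldingBounded`); `incEisCusp`, `incEisCusp_eq_of_lt_im`, `isAutomorphic_incEisCusp`,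
`norm_incEisCusp_le` (`FuchsianIncompleteEisensteinCusp`); `summable_incEis_term`
(`FuchsianIncompleteEisenstein`); `eisScattering`, `cuspMeanAt_eisCusp`
(`FuchsianEisensteinConstantTerm`); `norm_eisCusp_frame_sub_cpow_le`, `norm_eisCusp_frame_le_of_ne`,
`exists_norm_eisCusp_le_invHeight_rpow`, `eisGrowthConst` (`FuchsianEisensteinGrowth`); `eisCusp`,
`eisTerm`, `summable_eisTerm`, `isC2_and_eigen_eisCusp` (`FuchsianEisensteinSeries`); `invHeight`,
`exists_pos_le_invHeight`, `exists_smul_mem_cuspStrip_of_lt` (`FuchsianInvariantHeight`);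
`upperRightHom_one_mem_of_periods` (`FuchsianCuspZones`); `cuspMeanAt_apply` (`FuchsianCuspidalSubspace`).
-/

noncomputable section

namespace Literature.NumberTheory.Automorphic

open Matrix UpperHalfPlane
open scoped MatrixGroups

namespace Fuchsian

variable {Γ : Subgroup (GL (Fin 2) ℝ)} {h : ℕ} {𝔞 : Fin h → OnePoint ℝ} {σ : Fin h → SL(2, ℝ)}

/-! ## 1. Cut powers and the linearity of `ψ ↦ E(z|ψ)` -/

section Profiles

open _root_.MeasureTheory _root_.Set _root_.Filter
open scoped _root_.Pointwise _root_.ENNReal _root_.Topology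

/-- The cut power `y^w 𝟙_{y > Y}`. [cite: Iwaniec2002, (6.29), PDF p. 88] -/
def cutHigh (w : ℂ) (Y : ℝ) (t : ℝ) : ℂ := if Y < t then ((t : ℝ) : ℂ) ^ w else 0

/-- The cut power `y^s 𝟙_{y ≤ Y}`. [cite: Iwaniec2002, (6.29), PDF p. 88] -/
def cutLow (s : ℂ) (Y : ℝ) (t : ℝ) : ℂ := if t ≤ Y then ((t : ℝ) : ℂ) ^ s else 0

/-- The cut power vanishes below `Y`. [folklore] -/
theorem cutHigh_of_le {w : ℂ} {Y t : ℝ} (ht : t ≤ Y) : cutHigh w Y t = 0 := by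
  unfold cutHigh; rw [if_neg (not_lt.mpr ht)]

/-- The cut power above `Y`. [folklore] -/
theorem cutHigh_of_lt {w : ℂ} {Y t : ℝ} (ht : Y < t) : cutHigh w Y t = ((t : ℝ) : ℂ) ^ w := by
  unfold cutHigh; rw [if_pos ht]

/-- `y^s = y^s𝟙_{y≤Y} + y^s𝟙_{y>Y}`. [folklore] -/
theorem cutLow_add_cutHigh (s : ℂ) (Y t : ℝ) : cutLow s Y t + cutHigh s Y t = ((t : ℝ) : ℂ) ^ s := by
  unfold cutLow cutHigh
  by_cases h : t ≤ Y
  · rw [if_pos h, if_neg (not_lt.mpr h), add_zero]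
  · rw [if_neg h, if_pos (not_le.mp h), zero_add]

/-- `cutHigh` is measurable. [folklore] -/
theorem measurable_cutHigh (w : ℂ) (Y : ℝ) : Measurable (cutHigh w Y) := by
  unfold cutHigh
  exact Measurable.ite measurableSet_Ioi (Complex.measurable_ofReal.pow_const w) measurable_const

/-- `cutLow` is measurable. [folklore] -/
theorem measurable_cutLow (s : ℂ) (Y : ℝ) : Measurable (cutLow s Y) := by
  unfold cutLow
  exact Measurable.ite measurableSet_Iic (Complex.measurable_ofReal.pow_const s) measurable_const

/-- `|y^w 𝟙_{y>Y}| ≤ Y^{Re w}` when `Re w ≤ 0`, `Y > 0`. [folklore] -/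
theorem norm_cutHigh_le {w : ℂ} (hw : w.re ≤ 0) {Y : ℝ} (hY : 0 < Y) (t : ℝ) : ‖cutHigh w Y t‖ ≤ Y ^ w.re := by
  unfold cutHigh
  split_ifs with ht
  · have ht0 : 0 < t := hY.trans ht
    rw [Complex.norm_cpow_eq_rpow_re_of_pos ht0]
    exact Real.rpow_le_rpow_of_nonpos hY ht.le hw
  · rw [norm_zero]; positivity

/-- The truncation profile through the cut powers:
`ψᵢⱼ = δᵢⱼ · y^s𝟙_{y>Y} + φᵢⱼ(s) · y^{1-s}𝟙_{y>Y}`. [cite: Iwaniec2002, (6.29), PDF p. 88] -/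
theorem truncProfile_eq (i j : Fin h) (s : ℂ) (Y t : ℝ) :
    truncProfile Γ σ i j s Y t =
      (if i = j then 1 else 0) * cutHigh s Y t + eisScattering Γ σ i j s * cutHigh (1 - s) Y t := by
  unfold truncProfile cutHigh
  split_ifs <;> ring

/-- **Linearity of `ψ ↦ E(z|ψ)`**: constants. [folklore] -/
theorem incEis_const_mul (c : ℂ) (ψ : ℝ → ℂ) (z : ℍ) :
    incEis Γ (fun t => c * ψ t) z = c * incEis Γ ψ z := by
  unfold incEis; rw [tsum_mul_left]; ring

/-- **Linearity of `ψ ↦ E(z|ψ)`**: sums (both series summable at `z`). [folklore] -/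
theorem incEis_add {ψ₁ ψ₂ : ℝ → ℂ} {z : ℍ} (h₁ : Summable fun r : rows Γ => ψ₁ (rowIm r.1 z))
    (h₂ : Summable fun r : rows Γ => ψ₂ (rowIm r.1 z)) :
    incEis Γ (fun t => ψ₁ t + ψ₂ t) z = incEis Γ ψ₁ z + incEis Γ ψ₂ z := by
  unfold incEis; rw [h₁.tsum_add h₂]; ring

/-- `E_∞(z, s) = E(z|y^s)`. [cite: Iwaniec2002, §3.2 (3.11)–(3.12), PDF p. 43] -/
theorem eisInfty_eq_incEis (z : ℍ) (s : ℂ) : eisInfty Γ z s = incEis Γ (fun t => ((t : ℝ) : ℂ) ^ s) z := rfl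

/-- `E_𝔞(z, s) = E_𝔞(z|y^s)`. [cite: Iwaniec2002, §3.2 (3.11)–(3.12), PDF p. 43] -/
theorem eisCusp_eq_incEisCusp (s' : SL(2, ℝ)) (z : ℍ) (s : ℂ) :
    eisCusp Γ s' z s = incEisCusp Γ s' (fun t => ((t : ℝ) : ℂ) ^ s) z := rfl

/-- **Splitting the Eisenstein series at the height `Y`**: `E_𝔞(z, s) = E_𝔞(z|y^s𝟙_{y≤Y}) + E_𝔞(z|y^s𝟙_{y>Y})`
for `Re s > 1` (the second series is a finite sum). [cite: Iwaniec2002, (6.29), PDF p. 88] -/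
theorem eisCusp_eq_low_add_high
    (hΓ : Γ ≤ (Matrix.SpecialLinearGroup.toGL : SL(2, ℝ) →* GL (Fin 2) ℝ).range)
    (hd : IsDiscreteSubgroup Γ) (s' : SL(2, ℝ))
    (hper : (ConjAct.toConjAct (Matrix.SpecialLinearGroup.toGL s' : GL (Fin 2) ℝ)⁻¹ • Γ).strictPeriods =
      AddSubgroup.zmultiples 1)
    {s : ℂ} (hs : 1 < s.re) {Y : ℝ} (hY : 0 < Y) (z : ℍ) :
    eisCusp Γ s' z s = incEisCusp Γ s' (cutLow s Y) z + incEisCusp Γ s' (cutHigh s Y) z := by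
  set Γ' : Subgroup (GL (Fin 2) ℝ) := ConjAct.toConjAct (Matrix.SpecialLinearGroup.toGL s' : GL (Fin 2) ℝ)⁻¹ • Γ with hΓ'
  have hle : Γ' ≤ (Matrix.SpecialLinearGroup.toGL : SL(2, ℝ) →* GL (Fin 2) ℝ).range := by
    rw [hΓ', ← map_inv]; exact conj_le_range hΓ s'⁻¹
  have hd' : IsDiscreteSubgroup Γ' := hd.conj _
  have hT' : Matrix.GeneralLinearGroup.upperRightHom (1 : ℝ) ∈ Γ' := upperRightHom_one_mem_of_periods hper
  set w : ℍ := s'⁻¹ • z with hw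
  have hhigh : Summable fun r : rows Γ' => cutHigh s Y (rowIm r.1 w) :=
    summable_incEis_term hle hd' hT' (fun _ ht => cutHigh_of_le ht.le) hY w
  have hlow : Summable fun r : rows Γ' => cutLow s Y (rowIm r.1 w) := by
    have hfull : Summable fun r : rows Γ' => eisTerm s r.1 w := summable_eisTerm hle hd' hT' hs w
    have e : (fun r : rows Γ' => cutLow s Y (rowIm r.1 w)) =
        fun r : rows Γ' => eisTerm s r.1 w - cutHigh s Y (rowIm r.1 w) := by
      funext r; unfold eisTerm; rw [← cutLow_add_cutHigh s Y]; ring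
    rw [e]; exact hfull.sub hhigh
  rw [eisCusp_eq_incEisCusp]
  show incEis Γ' (fun t => ((t : ℝ) : ℂ) ^ s) w = incEis Γ' (cutLow s Y) w + incEis Γ' (cutHigh s Y) w
  rw [← incEis_add hlow hhigh]
  congr 1; funext t; rw [cutLow_add_cutHigh]

end Profiles

/-! ## 2. The decomposition `E^Y_𝔞(s) = E_𝔞(·|y^s𝟙_{y≤Y}) - Σₖ φ_𝔞ₖ(s) E_𝔞ₖ(·|y^{1-s}𝟙_{y>Y})` -/

section Decomposition

open _root_.MeasureTheory _root_.Set _root_.Filter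
open scoped _root_.Pointwise _root_.ENNReal _root_.Topology

/-- **The truncated Eisenstein series as a combination of incomplete Eisenstein series with cut powers**:
for `Re s > 1`, `Y > 0`,
`E^Y_𝔞ᵢ(z, s) = E_𝔞ᵢ(z|y^s𝟙_{y≤Y}) - Σₖ φᵢₖ(s) E_𝔞ₖ(z|y^{1-s}𝟙_{y>Y})`
(because `E_𝔞ᵢ(·|y^s𝟙_{y>Y})` IS the `δ`-part of its own correction). Every piece is a BOUNDED
automorphic function (§3), which is what makes the pairings of two truncated Eisenstein series
absolutely convergent on `F`. [cite: Iwaniec2002, (6.29)–(6.30), PDF p. 88] -/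
theorem eisTrunc_eq_decomp
    (hΓ : Γ ≤ (Matrix.SpecialLinearGroup.toGL : SL(2, ℝ) →* GL (Fin 2) ℝ).range)
    (hd : IsDiscreteSubgroup Γ)
    (hper : ∀ i, (ConjAct.toConjAct (Matrix.SpecialLinearGroup.toGL (σ i) : GL (Fin 2) ℝ)⁻¹ • Γ).strictPeriods =
      AddSubgroup.zmultiples 1)
    (i : Fin h) {s : ℂ} (hs : 1 < s.re) {Y : ℝ} (hY : 0 < Y) (z : ℍ) :
    eisTrunc Γ σ i s Y z = incEisCusp Γ (σ i) (cutLow s Y) z -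
      ∑ k, eisScattering Γ σ i k s * incEisCusp Γ (σ k) (cutHigh (1 - s) Y) z := by
  unfold eisTrunc
  rw [eisCusp_eq_low_add_high hΓ hd (σ i) (hper i) hs hY z]
  -- expand the corrections
  have hk : ∀ k, incEisCusp Γ (σ k) (truncProfile Γ σ i k s Y) z =
      (if i = k then 1 else 0) * incEisCusp Γ (σ k) (cutHigh s Y) z +
        eisScattering Γ σ i k s * incEisCusp Γ (σ k) (cutHigh (1 - s) Y) z := by
    intro k
    set Γk : Subgroup (GL (Fin 2) ℝ) := ConjAct.toConjAct (Matrix.SpecialLinearGroup.toGL (σ k) : GL (Fin 2) ℝ)⁻¹ • Γ with hΓk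
    have hle : Γk ≤ (Matrix.SpecialLinearGroup.toGL : SL(2, ℝ) →* GL (Fin 2) ℝ).range := by
      rw [hΓk, ← map_inv]; exact conj_le_range hΓ (σ k)⁻¹
    have hd' : IsDiscreteSubgroup Γk := hd.conj _
    have hT' : Matrix.GeneralLinearGroup.upperRightHom (1 : ℝ) ∈ Γk := upperRightHom_one_mem_of_periods (hper k)
    set w : ℍ := (σ k)⁻¹ • z
    have h1 : Summable fun r : rows Γk => (if i = k then (1 : ℂ) else 0) * cutHigh s Y (rowIm r.1 w) :=
      (summable_incEis_term hle hd' hT' (fun _ ht => cutHigh_of_le ht.le) hY w).mul_left _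
    have h2 : Summable fun r : rows Γk => eisScattering Γ σ i k s * cutHigh (1 - s) Y (rowIm r.1 w) :=
      (summable_incEis_term hle hd' hT' (fun _ ht => cutHigh_of_le ht.le) hY w).mul_left _
    have e : truncProfile Γ σ i k s Y = fun t =>
        (if i = k then (1 : ℂ) else 0) * cutHigh s Y t + eisScattering Γ σ i k s * cutHigh (1 - s) Y t := by
      funext t; exact truncProfile_eq i k s Y t
    show incEis Γk (truncProfile Γ σ i k s Y) w = (if i = k then 1 else 0) * incEis Γk (cutHigh s Y) w +
      eisScattering Γ σ i k s * incEis Γk (cutHigh (1 - s) Y) w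
    rw [e, incEis_add (ψ₁ := fun t => (if i = k then (1 : ℂ) else 0) * cutHigh s Y t)
      (ψ₂ := fun t => eisScattering Γ σ i k s * cutHigh (1 - s) Y t) h1 h2, incEis_const_mul, incEis_const_mul]
  simp_rw [hk]
  rw [Finset.sum_add_distrib]
  simp_rw [boole_mul]
  rw [Finset.sum_ite_eq Finset.univ i, if_pos (Finset.mem_univ i)]
  ring

end Decomposition

/-! ## 3. The pieces: boundedness, measurability, constant terms above `Y` -/

section Pieces

open _root_.MeasureTheory _root_.Set _root_.Filter
open scoped _root_.Pointwise _root_.ENNReal _root_.Topology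

variable (hΓ : Γ ≤ (Matrix.SpecialLinearGroup.toGL : SL(2, ℝ) →* GL (Fin 2) ℝ).range)
  (hneg : (-1 : GL (Fin 2) ℝ) ∈ Γ) (hd : IsDiscreteSubgroup Γ)
  (hinfty : ∀ i, (Matrix.SpecialLinearGroup.toGL (σ i) : GL (Fin 2) ℝ) • (OnePoint.infty : OnePoint ℝ) = 𝔞 i)
  (hper : ∀ i, (ConjAct.toConjAct (Matrix.SpecialLinearGroup.toGL (σ i) : GL (Fin 2) ℝ)⁻¹ • Γ).strictPeriods =
    AddSubgroup.zmultiples 1)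
  (hineq : ∀ i j, ∀ γ ∈ Γ, γ • 𝔞 i = 𝔞 j → i = j)

include hΓ hd hper in
/-- **`E_𝔞ₖ(·|y^w𝟙_{y>Y})` is bounded** by `Y^{Re w}(1 + 36/Y)` (`Re w ≤ 0`, `Y > 0`). [cite: Iwaniec2002, Lemma 2.10 & (6.29), PDF pp. 38, 88] -/
theorem norm_incEisCusp_cutHigh_le (k : Fin h) {w : ℂ} (hw : w.re ≤ 0) {Y : ℝ} (hY : 0 < Y) (z : ℍ) :
    ‖incEisCusp Γ (σ k) (cutHigh w Y) z‖ ≤ Y ^ w.re * (1 + 36 / Y) :=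
  norm_incEisCusp_le hΓ hd (σ k) (hper k) (fun _ ht => cutHigh_of_le ht.le) hY (norm_cutHigh_le hw hY) z

include hΓ hd hper in
/-- `E_𝔞ₖ(·|y^w𝟙_{y>Y})` is measurable. [folklore] -/
theorem measurable_incEisCusp_cutHigh (k : Fin h) (w : ℂ) {Y : ℝ} (hY : 0 < Y) :
    Measurable (incEisCusp Γ (σ k) (cutHigh w Y)) :=
  measurable_incEisCusp hΓ hd (σ k) (hper k) (measurable_cutHigh w Y) (fun _ ht => cutHigh_of_le ht.le) hY

include hΓ hneg hd hinfty hper hineq in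
/-- **`E_𝔞ₖ(·|y^w𝟙_{y>Y})` on the horocycles above `Y` at every cusp**: for `Y ≥ 1`, `y > Y`,
`E_𝔞ₖ(σₗ(x + iy)|y^w𝟙_{y>Y}) = δₖₗ y^w` (pointwise). [cite: Iwaniec2002, (3.16) & (6.29), PDF pp. 44, 88] -/
theorem incEisCusp_cutHigh_horocycle (k l : Fin h) (w : ℂ) {Y : ℝ} (hY : 1 ≤ Y) {y : ℝ} (hy : Y < y) (x : ℝ) :
    incEisCusp Γ (σ k) (cutHigh w Y) (σ l • ((x : ℝ) +ᵥ UpperHalfPlane.ofComplex (⟨0, y⟩ : ℂ))) =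
      if k = l then ((y : ℝ) : ℂ) ^ w else 0 := by
  have hy0 : 0 < y := by linarith
  have hY0 : 0 < Y := by linarith
  set u : ℍ := (x : ℝ) +ᵥ UpperHalfPlane.ofComplex (⟨0, y⟩ : ℂ) with hu
  have hui : u.im = y := im_vadd_ofComplex x hy0
  by_cases hkl : k = l
  · subst hkl
    rw [if_pos rfl]
    have hz : 1 / Y < ((σ k)⁻¹ • σ k • u).im := by
      rw [inv_smul_smul, hui]
      calc 1 / Y ≤ 1 := by rw [div_le_one hY0]; exact hY
        _ ≤ Y := hY
        _ < y := hy
    rw [incEisCusp_eq_of_lt_im hΓ hneg hd (σ k) (hper k) (ψ := cutHigh w Y) hY0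
      (fun _ ht => cutHigh_of_le ht.le) hz, inv_smul_smul, hui, cutHigh_of_lt hy]
  · rw [if_neg hkl]
    have huY : 1 / u.im ≤ Y := by
      rw [hui, div_le_iff₀ hy0]
      nlinarith
    exact incEisCusp_frame_eq_zero_of_ne hΓ hd hinfty hper hineq hkl (ψ := cutHigh w Y)
      (fun _ ht => cutHigh_of_le ht) huY

include hΓ hneg hd hinfty hper hineq in
/-- Hence its constant term at `𝔞ₗ` above `Y` is `δₖₗ y^w`. [cite: Iwaniec2002, (6.29)–(6.30), PDF p. 88] -/
theorem cuspMeanAt_incEisCusp_cutHigh (k l : Fin h) (w : ℂ) {Y : ℝ} (hY : 1 ≤ Y) {y : ℝ} (hy : Y < y) :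
    cuspMeanAt (σ l) (incEisCusp Γ (σ k) (cutHigh w Y)) (UpperHalfPlane.ofComplex ⟨0, y⟩) =
      if k = l then ((y : ℝ) : ℂ) ^ w else 0 := by
  rw [cuspMeanAt_apply]
  simp_rw [incEisCusp_cutHigh_horocycle hΓ hneg hd hinfty hper hineq k l w hY hy]
  rw [intervalIntegral.integral_const]; simp

include hΓ hneg hd hinfty hper hineq in
/-- **The low piece `E_𝔞ᵢ(·|y^s𝟙_{y≤Y})` on the horocycles above `Y`**:
`E_𝔞ᵢ(σₗ(x+iy)|y^s𝟙_{y≤Y}) = E_𝔞ᵢ(σₗ(x+iy), s) - δᵢₗ y^s`. [cite: Iwaniec2002, (6.29), PDF p. 88] -/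
theorem incEisCusp_cutLow_horocycle (i l : Fin h) {s : ℂ} (hs : 1 < s.re) {Y : ℝ} (hY : 1 ≤ Y) {y : ℝ}
    (hy : Y < y) (x : ℝ) :
    incEisCusp Γ (σ i) (cutLow s Y) (σ l • ((x : ℝ) +ᵥ UpperHalfPlane.ofComplex (⟨0, y⟩ : ℂ))) =
      eisCusp Γ (σ i) (σ l • ((x : ℝ) +ᵥ UpperHalfPlane.ofComplex (⟨0, y⟩ : ℂ))) s -
        if i = l then ((y : ℝ) : ℂ) ^ s else 0 := by
  have hY0 : 0 < Y := by linarith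
  rw [eisCusp_eq_low_add_high hΓ hd (σ i) (hper i) hs hY0,
    incEisCusp_cutHigh_horocycle hΓ hneg hd hinfty hper hineq i l s hY hy x]
  ring

include hΓ hneg hd hinfty hper hineq in
/-- Hence the constant term of the low piece at `𝔞ₗ` above `Y` is the full reflected term
`φᵢₗ(s) y^{1-s}` (`Re s > 1`). [cite: Iwaniec2002, (6.29)–(6.30) & (3.20), PDF pp. 46, 88] -/
theorem cuspMeanAt_incEisCusp_cutLow (i l : Fin h) {s : ℂ} (hs : 1 < s.re) {Y : ℝ} (hY : 1 ≤ Y) {y : ℝ}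
    (hy : Y < y) :
    cuspMeanAt (σ l) (incEisCusp Γ (σ i) (cutLow s Y)) (UpperHalfPlane.ofComplex ⟨0, y⟩) =
      eisScattering Γ σ i l s * ((y : ℝ) : ℂ) ^ (1 - s) := by
  have hy0 : 0 < y := by linarith
  have hT : Matrix.GeneralLinearGroup.upperRightHom (1 : ℝ) ∈
      ConjAct.toConjAct (Matrix.SpecialLinearGroup.toGL (σ i) : GL (Fin 2) ℝ)⁻¹ • Γ :=
    upperRightHom_one_mem_of_periods (hper i)
  have hEc : Continuous fun z => eisCusp Γ (σ i) z s := (isC2_and_eigen_eisCusp hΓ hd (σ i) hT hs).1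
  have hvc : Continuous fun x : ℝ => (x : ℝ) +ᵥ UpperHalfPlane.ofComplex (⟨0, y⟩ : ℂ) :=
    continuous_vadd₂.comp (continuous_id.prodMk continuous_const)
  have hint : IntervalIntegrable
      (fun x : ℝ => eisCusp Γ (σ i) (σ l • ((x : ℝ) +ᵥ UpperHalfPlane.ofComplex (⟨0, y⟩ : ℂ))) s) volume 0 1 :=
    (hEc.comp ((continuous_const_smul (σ l)).comp hvc)).intervalIntegrable _ _
  rw [cuspMeanAt_apply]
  simp_rw [incEisCusp_cutLow_horocycle hΓ hneg hd hinfty hper hineq i l hs hY hy]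
  rw [intervalIntegral.integral_sub hint intervalIntegrable_const, intervalIntegral.integral_const]
  have hcm := cuspMeanAt_eisCusp hΓ hneg hd hinfty hper hineq hs i l hy0
  rw [cuspMeanAt_apply] at hcm
  rw [hcm]
  simp

include hΓ hd hper in
/-- The low piece is measurable. [folklore] -/
theorem measurable_incEisCusp_cutLow (i : Fin h) {s : ℂ} (hs : 1 < s.re) {Y : ℝ} (hY : 0 < Y) :
    Measurable (incEisCusp Γ (σ i) (cutLow s Y)) := by
  have hT : Matrix.GeneralLinearGroup.upperRightHom (1 : ℝ) ∈
      ConjAct.toConjAct (Matrix.SpecialLinearGroup.toGL (σ i) : GL (Fin 2) ℝ)⁻¹ • Γ :=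
    upperRightHom_one_mem_of_periods (hper i)
  have hEc : Continuous fun z => eisCusp Γ (σ i) z s := (isC2_and_eigen_eisCusp hΓ hd (σ i) hT hs).1
  have e : incEisCusp Γ (σ i) (cutLow s Y) = fun z => eisCusp Γ (σ i) z s - incEisCusp Γ (σ i) (cutHigh s Y) z := by
    funext z; rw [eisCusp_eq_low_add_high hΓ hd (σ i) (hper i) hs hY z]; ring
  rw [e]
  exact hEc.measurable.sub (measurable_incEisCusp_cutHigh hΓ hd hper i s hY)

include hΓ hneg hd hinfty hper hineq in
/-- **The low piece is bounded on `ℍ`** (finite volume, complete cusp system, `Re s > 1`, `Y ≥ 1`):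
below `Y` it is `E_𝔞ᵢ ≪ Y^σ`, in the zone of `𝔞ⱼ` it is `E_𝔞ᵢ(σⱼu, s) - δᵢⱼ (Im u)^s = O(1)`.
[cite: Iwaniec2002, (3.20) & (6.29), PDF pp. 46, 88] -/
theorem exists_norm_incEisCusp_cutLow_le {F : Set ℍ} (hF : IsHypFundamentalDomain Γ F) (hvol : volume F < ⊤)
    (hcomplete : ∀ c : OnePoint ℝ, IsCusp c Γ → ∃ i, ∃ γ ∈ Γ, γ • 𝔞 i = c)
    (i : Fin h) {s : ℂ} (hs : 1 < s.re) {Y : ℝ} (hY : 1 ≤ Y) :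
    ∃ B : ℝ, ∀ z : ℍ, ‖incEisCusp Γ (σ i) (cutLow s Y) z‖ ≤ B := by
  have ee : ∀ (x : SL(2, ℝ)) (w : ℍ), (Matrix.SpecialLinearGroup.toGL x : GL (Fin 2) ℝ) • w = x • w :=
    fun x w => rfl
  have hY0 : 0 < Y := by linarith
  obtain ⟨C, hC0, hC⟩ := exists_norm_eisCusp_le_invHeight_rpow hΓ hneg hd hF hvol hinfty hper hineq hcomplete hs i
  set c : ℝ := eisGrowthConst s.re with hc
  have hcpos : 0 < c := eisGrowthConst_pos hs
  have haut : IsAutomorphic Γ (incEisCusp Γ (σ i) (cutLow s Y)) := isAutomorphic_incEisCusp hΓ (σ i) _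
  have hrepr : ∀ z, incEisCusp Γ (σ i) (cutLow s Y) z = eisCusp Γ (σ i) z s - incEisCusp Γ (σ i) (cutHigh s Y) z := by
    intro z; rw [eisCusp_eq_low_add_high hΓ hd (σ i) (hper i) hs hY0 z]; ring
  refine ⟨max (C * Y ^ s.re) c, fun z => ?_⟩
  by_cases hle : invHeight Γ σ z ≤ Y
  · rw [hrepr, incEisCusp_eq_zero_of_invHeight_le hΓ hd hper i (ψ := cutHigh s Y) (fun _ ht => cutHigh_of_le ht) hle,
      sub_zero]
    refine (hC z).trans (le_trans ?_ (le_max_left _ _))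
    have hyz : 0 < invHeight Γ σ z := by
      obtain ⟨c₀, hc₀, hle'⟩ := exists_pos_le_invHeight hΓ hneg hd hF hvol hinfty hper hcomplete i
      exact hc₀.trans_le (hle' z)
    exact mul_le_mul_of_nonneg_left (Real.rpow_le_rpow hyz.le hle (by linarith)) hC0
  · rw [not_le] at hle
    obtain ⟨γ, hγ, j, u, hu, e⟩ := exists_smul_mem_cuspStrip_of_lt hper hY0.le hle
    have huY : Y < u.im := hu.2.2
    have hu1 : 1 ≤ u.im := by linarith
    -- `u = Re u +ᵥ (i Im u)`
    have hupt : u = (u.re : ℝ) +ᵥ UpperHalfPlane.ofComplex (⟨0, u.im⟩ : ℂ) := by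
      ext1
      rw [UpperHalfPlane.coe_vadd, UpperHalfPlane.ofComplex_apply_of_im_pos (z := (⟨0, u.im⟩ : ℂ)) u.im_pos]
      apply Complex.ext <;> simp
    rw [← haut γ hγ z, ← e, ee, hupt,
      incEisCusp_cutLow_horocycle hΓ hneg hd hinfty hper hineq i j hs hY huY u.re, ← hupt]
    refine le_trans ?_ (le_max_right _ _)
    have hp1 : u.im ^ (-s.re) ≤ 1 := Real.rpow_le_one_of_one_le_of_nonpos hu1 (by linarith)
    have hp2 : u.im ^ (1 - s.re) ≤ 1 := Real.rpow_le_one_of_one_le_of_nonpos hu1 (by linarith)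
    by_cases hij : i = j
    · subst hij
      rw [if_pos rfl]
      refine (norm_eisCusp_frame_sub_cpow_le hΓ hneg hd hper hs i u).trans ?_
      rw [← hc]; nlinarith
    · rw [if_neg hij, sub_zero]
      refine (norm_eisCusp_frame_le_of_ne hΓ hd hinfty hper hineq hs hij u).trans ?_
      rw [← hc]; nlinarith

end Pieces

/-! ## 4. The easy pairings of the Maass–Selberg relations -/

section Pairings

open _root_.MeasureTheory _root_.Set _root_.Filter
open scoped _root_.Pointwise _root_.ENNReal _root_.Topology

variable {F : Set ℍ}
variable (hΓ : Γ ≤ (Matrix.SpecialLinearGroup.toGL : SL(2, ℝ) →* GL (Fin 2) ℝ).range)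
  (hneg : (-1 : GL (Fin 2) ℝ) ∈ Γ) (hd : IsDiscreteSubgroup Γ) (hF : IsHypFundamentalDomain Γ F)
  (hinfty : ∀ i, (Matrix.SpecialLinearGroup.toGL (σ i) : GL (Fin 2) ℝ) • (OnePoint.infty : OnePoint ℝ) = 𝔞 i)
  (hper : ∀ i, (ConjAct.toConjAct (Matrix.SpecialLinearGroup.toGL (σ i) : GL (Fin 2) ℝ)⁻¹ • Γ).strictPeriods =
    AddSubgroup.zmultiples 1)
  (hineq : ∀ i j, ∀ γ ∈ Γ, γ • 𝔞 i = 𝔞 j → i = j)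

/-- `∫ |y^w 𝟙_{y>Y}| y⁻² < ∞` for `Re w < 1`, `Y > 0`. [folklore] -/
theorem integrableOn_norm_cutHigh {w : ℂ} (hw : w.re < 1) {Y : ℝ} (hY : 0 < Y) :
    IntegrableOn (fun y : ℝ => ‖cutHigh w Y y‖ * (y ^ 2)⁻¹) (Ioi 0) := by
  have h := integrableOn_highProfile (s := 1 - w) (by simp; linarith) hY
  refine h.congr_fun (fun y _ => ?_) measurableSet_Ioi
  simp only [cutHigh, sub_sub_cancel]

/-- The tail integral of the Maass–Selberg relations: `∫_Y^∞ y^{w₁} y^{w₂} y⁻² dy = -Y^{w₁+w₂-1}/(w₁+w₂-1)`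
for `Re(w₁ + w₂) < 1`. [cite: Iwaniec2002, (6.30), PDF p. 88] -/
theorem integral_tail_eq {w₁ w₂ : ℂ} (hw : (w₁ + w₂).re < 1) {Y : ℝ} (hY : 0 < Y) :
    ∫ y in Ioi (0 : ℝ), (cutHigh w₁ Y y * (((y ^ 2)⁻¹ : ℝ) : ℂ)) * (if Y < y then ((y : ℝ) : ℂ) ^ w₂ else 0) =
      -((Y : ℝ) : ℂ) ^ (w₁ + w₂ - 1) / (w₁ + w₂ - 1) := by
  have hsplit : ∫ y in Ioi (0 : ℝ), (cutHigh w₁ Y y * (((y ^ 2)⁻¹ : ℝ) : ℂ)) * (if Y < y then ((y : ℝ) : ℂ) ^ w₂ else 0) =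
      ∫ y in Ioi Y, ((y : ℝ) : ℂ) ^ (w₁ + w₂ - 2) := by
    rw [← integral_indicator measurableSet_Ioi, ← integral_indicator measurableSet_Ioi]
    refine integral_congr_ae (Eventually.of_forall fun y => ?_)
    by_cases hy : Y < y
    · have hy0 : 0 < y := hY.trans hy
      rw [indicator_of_mem (show y ∈ Ioi (0 : ℝ) from hy0), indicator_of_mem (show y ∈ Ioi Y from hy),
        if_pos hy, cutHigh_of_lt hy]
      have hy0' : ((y : ℝ) : ℂ) ≠ 0 := by exact_mod_cast hy0.ne'
      have e2 : (((y ^ 2)⁻¹ : ℝ) : ℂ) = ((y : ℝ) : ℂ) ^ (-2 : ℂ) := by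
        rw [Complex.cpow_neg, show (2 : ℂ) = ((2 : ℕ) : ℂ) by norm_num, Complex.cpow_natCast]
        push_cast; ring
      rw [e2, show w₁ + w₂ - 2 = w₁ + (-2 : ℂ) + w₂ by ring, Complex.cpow_add _ _ hy0', Complex.cpow_add _ _ hy0']
    · rw [indicator_of_notMem (show y ∉ Ioi Y from hy)]
      by_cases hy0 : 0 < y
      · rw [indicator_of_mem (show y ∈ Ioi (0 : ℝ) from hy0), if_neg hy, mul_zero]
      · rw [indicator_of_notMem (show y ∉ Ioi (0 : ℝ) from hy0)]
  have hre : (w₁ + w₂ - 2).re < -1 := by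
    have : (w₁ + w₂ - 2).re = (w₁ + w₂).re - 2 := by simp
    rw [this]; linarith
  rw [hsplit, integral_Ioi_cpow_of_lt hre hY]
  congr 1
  · rw [show w₁ + w₂ - 2 + 1 = w₁ + w₂ - 1 by ring]
  · ring

include hΓ hneg hd hF hinfty hper hineq in
/-- **Maass–Selberg, the high–high pairing**: for `Y ≥ 1`, `Re w₁, Re w₂ ≤ 0`,
`∫_F E_𝔞ₖ(z|y^{w₁}𝟙_{y>Y}) E_𝔞ₗ(z|y^{w₂}𝟙_{y>Y}) dμ = δₖₗ · (-Y^{w₁+w₂-1}/(w₁+w₂-1))`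
(unfold the first factor; the constant term of the second at `𝔞ₖ` above `Y` is `δₗₖ y^{w₂}`).
[cite: Iwaniec2002, Prop. 6.8 (6.30), PDF p. 88] -/
theorem pairing_cutHigh_cutHigh (k l : Fin h) {w₁ w₂ : ℂ} (hw₁ : w₁.re ≤ 0) (hw₂ : w₂.re ≤ 0)
    {Y : ℝ} (hY : 1 ≤ Y) :
    ∫ z in F, incEisCusp Γ (σ k) (cutHigh w₁ Y) z * incEisCusp Γ (σ l) (cutHigh w₂ Y) z =
      (if k = l then 1 else 0) * (-((Y : ℝ) : ℂ) ^ (w₁ + w₂ - 1) / (w₁ + w₂ - 1)) := by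
  have hY0 : 0 < Y := by linarith
  rw [setIntegral_incEisCusp_mul_of_bounded hΓ hneg hd hF (σ k) (hper k) (measurable_cutHigh w₁ Y)
    (integrableOn_norm_cutHigh (by linarith) hY0) (isAutomorphic_incEisCusp hΓ (σ l) _)
    (measurable_incEisCusp_cutHigh hΓ hd hper l w₂ hY0) (norm_incEisCusp_cutHigh_le hΓ hd hper l hw₂ hY0)]
  have e : ∀ y ∈ Ioi (0 : ℝ), (cutHigh w₁ Y y * (((y ^ 2)⁻¹ : ℝ) : ℂ)) *
      cuspMeanAt (σ k) (incEisCusp Γ (σ l) (cutHigh w₂ Y)) (UpperHalfPlane.ofComplex ⟨0, y⟩) =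
      (if k = l then (1 : ℂ) else 0) *
        ((cutHigh w₁ Y y * (((y ^ 2)⁻¹ : ℝ) : ℂ)) * (if Y < y then ((y : ℝ) : ℂ) ^ w₂ else 0)) := by
    intro y _
    by_cases hy : Y < y
    · rw [cuspMeanAt_incEisCusp_cutHigh hΓ hneg hd hinfty hper hineq l k w₂ hY hy, if_pos hy]
      by_cases hkl : k = l
      · subst hkl; simp
      · rw [if_neg hkl, if_neg (Ne.symm hkl)]; simp
    · rw [cutHigh_of_le (not_lt.mp hy)]; simp
  have hw : (w₁ + w₂).re < 1 := by simp only [Complex.add_re]; linarith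
  rw [setIntegral_congr_fun measurableSet_Ioi e, integral_const_mul, integral_tail_eq hw hY0]

include hΓ hneg hd hF hinfty hper hineq in
/-- **Maass–Selberg, the low–high pairing**: for a finite volume group with a complete cusp system,
`Re s > 1`, `Re w ≤ 0`, `Y ≥ 1`,
`∫_F E_𝔞ᵢ(z|y^s𝟙_{y≤Y}) E_𝔞ₖ(z|y^w𝟙_{y>Y}) dμ = φᵢₖ(s) · (-Y^{w-s}/(w-s))`
(unfold the second factor; the constant term of the low piece at `𝔞ₖ` above `Y` is `φᵢₖ(s)y^{1-s}`).
[cite: Iwaniec2002, Prop. 6.8 (6.30), PDF p. 88] -/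
theorem pairing_cutLow_cutHigh (hvol : volume F < ⊤)
    (hcomplete : ∀ c : OnePoint ℝ, IsCusp c Γ → ∃ i, ∃ γ ∈ Γ, γ • 𝔞 i = c)
    (i k : Fin h) {s : ℂ} (hs : 1 < s.re) {w : ℂ} (hw : w.re ≤ 0) {Y : ℝ} (hY : 1 ≤ Y) :
    ∫ z in F, incEisCusp Γ (σ i) (cutLow s Y) z * incEisCusp Γ (σ k) (cutHigh w Y) z =
      eisScattering Γ σ i k s * (-((Y : ℝ) : ℂ) ^ (w + (1 - s) - 1) / (w + (1 - s) - 1)) := by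
  have hY0 : 0 < Y := by linarith
  obtain ⟨B, hB⟩ := exists_norm_incEisCusp_cutLow_le hΓ hneg hd hinfty hper hineq hF hvol hcomplete i hs hY
  have ecomm : (fun z => incEisCusp Γ (σ i) (cutLow s Y) z * incEisCusp Γ (σ k) (cutHigh w Y) z) =
      fun z => incEisCusp Γ (σ k) (cutHigh w Y) z * incEisCusp Γ (σ i) (cutLow s Y) z :=
    funext fun z => mul_comm _ _
  rw [ecomm, setIntegral_incEisCusp_mul_of_bounded hΓ hneg hd hF (σ k) (hper k) (measurable_cutHigh w Y)
    (integrableOn_norm_cutHigh (by linarith) hY0) (isAutomorphic_incEisCusp hΓ (σ i) _)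
    (measurable_incEisCusp_cutLow hΓ hd hper i hs hY0) hB]
  have e : ∀ y ∈ Ioi (0 : ℝ), (cutHigh w Y y * (((y ^ 2)⁻¹ : ℝ) : ℂ)) *
      cuspMeanAt (σ k) (incEisCusp Γ (σ i) (cutLow s Y)) (UpperHalfPlane.ofComplex ⟨0, y⟩) =
      eisScattering Γ σ i k s *
        ((cutHigh w Y y * (((y ^ 2)⁻¹ : ℝ) : ℂ)) * (if Y < y then ((y : ℝ) : ℂ) ^ (1 - s) else 0)) := by
    intro y _
    by_cases hy : Y < y
    · rw [cuspMeanAt_incEisCusp_cutLow hΓ hneg hd hinfty hper hineq i k hs hY hy, if_pos hy]; ring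
    · rw [cutHigh_of_le (not_lt.mp hy)]; simp
  have hw' : (w + (1 - s)).re < 1 := by simp only [Complex.add_re, Complex.sub_re, Complex.one_re]; linarith
  rw [setIntegral_congr_fun measurableSet_Ioi e, integral_const_mul, integral_tail_eq hw' hY0]

end Pairings

end Fuchsian

end Literature.NumberTheory.Automorphic

end
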